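import Summits.KontsevichZagierPeriods.KontsevichZagierPeriods.Theorems.DihedralNormalForm.Negative.TwoSlices
import Summits.KontsevichZagierPeriods.KontsevichZagierPeriods.Theorems.DihedralNormalForm.Negative.LoadBearing

/-!
# `DihedralNormalForm` (stmt-KontsevichZagierPeriods-3912): negative side — the two-coordinate push-forward invariant

Part 2/4 of the certified proof that rule (2) is load-bearing (work file §9).  For a generator
`[r]` of dimension `n` its DENSITY `dens n r : ℝ² → ℝ` is the push-forward of `f·λ|_σ` to the first
two coordinates when `n ≥ 2` (integrate out the others along `cons2`), and for `n ≤ 1` the data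
embedded along the far-away strip `x₁ ∈ [2,3]` (`stripInd`).  Modulo the subgroup `Nul` of a.e.-zero
functions and the subgroup `Dsub` generated by the density differences of Newton–Leibniz instances
with base dimension `≤ 1` (`DgenOne`, `DgenZero`), the density is additive on the free abelian
group: `invariant : KZ.FormalRep →+ (ℝ × ℝ → ℝ) ⧸ (Nul ⊔ Dsub)`.  Main result
`relationsWithoutCoV_le_ker`: the invariant KILLS the sub-calculus generated by domain additivity,
integrand additivity and Newton–Leibniz (`relationsWithoutCoV`, `LoadBearing.lean`) — additivity
moves are additive on densities a.e. (Fubini for null overlaps), and a Newton–Leibniz move in a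
coordinate beyond the first two does not change the density (`dens_newtonLeibniz_two_add`:
`TwoSlices.integral_band_eq` on every a.e.-integrable two-coordinate slice).  It does NOT kill
changes of variables (a transposition of coordinates changes the density), which is the point.

[Kontsevich–Zagier 2001, §1.2] -/

noncomputable section

open MeasureTheory Set Filter
open Literature.NumberTheory.Transcendental

namespace Summit.KontsevichZagierPeriods.DihedralNormalForm.Negative

variable {m : ℕ}

/-! ### The far-away strip, densities -/

/-- Indicator of the far-away interval `[2,3]`. -/
def stripInd (t : ℝ) : ℝ := (Icc (2 : ℝ) 3).indicator (fun _ => (1 : ℝ)) t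

/-- The strip indicator vanishes left of `2`. [folklore] -/
theorem stripInd_of_lt {t : ℝ} (ht : t < 2) : stripInd t = 0 := by
  unfold stripInd
  apply indicator_of_notMem
  intro h
  exact absurd h.1 (not_le.mpr ht)

/-- **The density of a generator**: push-forward of `f·λ|_σ` to the first two coordinates for
dimension `≥ 2`; for dimensions `1`, `0` the data are embedded along the far-away strip. -/
def dens : (n : ℕ) → KZ.IntegralRep n → ℝ × ℝ → ℝ
  | 0, r => fun q => r.domain.indicator r.integrand ![] * (stripInd q.1 * stripInd q.2)
  | 1, r => fun q => r.domain.indicator r.integrand ![q.1] * stripInd q.2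
  | _ + 2, r => fun q => ∫ x, r.domain.indicator r.integrand (cons2 (q, x))

/-- The density in dimension `m + 2`, unfolded. [folklore] -/
theorem dens_two_add (r : KZ.IntegralRep (m + 2)) (q : ℝ × ℝ) :
    dens (m + 2) r q = ∫ x, r.domain.indicator r.integrand (cons2 (q, x)) := rfl

/-- The density in dimension `1`, unfolded. [folklore] -/
theorem dens_one (r : KZ.IntegralRep 1) (q : ℝ × ℝ) :
    dens 1 r q = r.domain.indicator r.integrand ![q.1] * stripInd q.2 := rfl

/-- The density in dimension `0`, unfolded. [folklore] -/
theorem dens_zero (r : KZ.IntegralRep 0) (q : ℝ × ℝ) :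
    dens 0 r q = r.domain.indicator r.integrand ![] * (stripInd q.1 * stripInd q.2) := rfl

/-- The extended integrand of a representation is integrable. [folklore] -/
theorem integrable_indicator (r : KZ.IntegralRep m) : Integrable (r.domain.indicator r.integrand) :=
  (integrable_indicator_iff (KZ.IntegralRep.measurableSet_domain_holds r)).mpr r.integrableOn

/-! ### The null subgroup and the invariant's target -/

/-- Functions on `ℝ²` vanishing almost everywhere. -/
def Nul : AddSubgroup (ℝ × ℝ → ℝ) where
  carrier := {g | g =ᵐ[volume] 0}
  zero_mem' := show (0 : ℝ × ℝ → ℝ) =ᵐ[volume] 0 from Filter.EventuallyEq.rfl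
  add_mem' := fun {a b} (ha : a =ᵐ[volume] 0) (hb : b =ᵐ[volume] 0) =>
    show a + b =ᵐ[volume] 0 from by simpa using ha.add hb
  neg_mem' := fun {a} (ha : a =ᵐ[volume] 0) => show -a =ᵐ[volume] 0 from by simpa using ha.neg

/-- Membership in `Nul`. [folklore] -/
theorem mem_Nul {g : ℝ × ℝ → ℝ} : g ∈ Nul ↔ g =ᵐ[volume] 0 := Iff.rfl

/-! ### Pointwise additivity of extended integrands -/

/-- Pointwise additivity of the extended integrands of a domain-additivity instance off the overlap. [folklore] -/
theorem indicator_domainAdd {n : ℕ} {r r₁ r₂ : KZ.IntegralRep n}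
    (hdom : r.domain = r₁.domain ∪ r₂.domain)
    (h₁ : EqOn r.integrand r₁.integrand r₁.domain) (h₂ : EqOn r.integrand r₂.integrand r₂.domain)
    {z : Fin n → ℝ} (hz : z ∉ r₁.domain ∩ r₂.domain) :
    r.domain.indicator r.integrand z =
      r₁.domain.indicator r₁.integrand z + r₂.domain.indicator r₂.integrand z := by
  by_cases hz1 : z ∈ r₁.domain
  · have hz2 : z ∉ r₂.domain := fun h => hz ⟨hz1, h⟩
    rw [indicator_of_mem (hdom ▸ Or.inl hz1), indicator_of_mem hz1, indicator_of_notMem hz2,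
      add_zero, h₁ hz1]
  · by_cases hz2 : z ∈ r₂.domain
    · rw [indicator_of_mem (hdom ▸ Or.inr hz2), indicator_of_notMem hz1, indicator_of_mem hz2,
        zero_add, h₂ hz2]
    · have hz0 : z ∉ r.domain := by rw [hdom]; rintro (h | h) <;> contradiction
      rw [indicator_of_notMem hz0, indicator_of_notMem hz1, indicator_of_notMem hz2, add_zero]

/-- Pointwise additivity of the extended integrands of an integrand-additivity instance. [folklore] -/
theorem indicator_integrandAdd {n : ℕ} {r r₁ r₂ : KZ.IntegralRep n}
    (hd₁ : r₁.domain = r.domain) (hd₂ : r₂.domain = r.domain)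
    (hadd : EqOn r.integrand (r₁.integrand + r₂.integrand) r.domain) (z : Fin n → ℝ) :
    r.domain.indicator r.integrand z =
      r₁.domain.indicator r₁.integrand z + r₂.domain.indicator r₂.integrand z := by
  by_cases hz : z ∈ r.domain
  · rw [indicator_of_mem hz, indicator_of_mem (hd₁ ▸ hz), indicator_of_mem (hd₂ ▸ hz), hadd hz]
    rfl
  · rw [indicator_of_notMem hz, indicator_of_notMem (hd₁ ▸ hz :), indicator_of_notMem (hd₂ ▸ hz :),
      add_zero]

/-! ### Vanishing on domain additivity -/

/-- In dimension `≥ 2`: the densities of a domain-additivity instance add almost everywhere.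
[folklore] -/
theorem dens_domainAdd_two_add {r r₁ r₂ : KZ.IntegralRep (m + 2)}
    (hdom : r.domain = r₁.domain ∪ r₂.domain) (hnull : volume (r₁.domain ∩ r₂.domain) = 0)
    (h₁ : EqOn r.integrand r₁.integrand r₁.domain) (h₂ : EqOn r.integrand r₂.integrand r₂.domain) :
    (dens (m + 2) r - dens (m + 2) r₁ - dens (m + 2) r₂) ∈ Nul := by
  rw [mem_Nul]
  filter_upwards [ae_integrable_slice2 (integrable_indicator r),
    ae_integrable_slice2 (integrable_indicator r₁), ae_integrable_slice2 (integrable_indicator r₂),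
    ae_volume_slice2_eq_zero (m := m) hnull] with q hq hq₁ hq₂ hqn
  simp only [Pi.sub_apply, Pi.zero_apply, dens_two_add]
  have e : ∫ x, (r.domain.indicator r.integrand (cons2 (q, x)) -
      r₁.domain.indicator r₁.integrand (cons2 (q, x)) - r₂.domain.indicator r₂.integrand (cons2 (q, x))) =
      (∫ x, r.domain.indicator r.integrand (cons2 (q, x))) -
        (∫ x, r₁.domain.indicator r₁.integrand (cons2 (q, x))) -
        ∫ x, r₂.domain.indicator r₂.integrand (cons2 (q, x)) := by
    have hq01 : Integrable (fun x => r.domain.indicator r.integrand (cons2 (q, x)) -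
        r₁.domain.indicator r₁.integrand (cons2 (q, x))) := hq.sub hq₁
    rw [← integral_sub hq hq₁, ← integral_sub hq01 hq₂]
  rw [← e]
  refine integral_eq_zero_of_ae ?_
  have hae : ∀ᵐ x : Fin m → ℝ, cons2 (q, x) ∉ r₁.domain ∩ r₂.domain :=
    (measure_eq_zero_iff_ae_notMem (s := {x : Fin m → ℝ | cons2 (q, x) ∈ r₁.domain ∩ r₂.domain})).1 hqn
  filter_upwards [hae] with x hx
  simp only [Pi.zero_apply]
  rw [indicator_domainAdd hdom h₁ h₂ hx]
  ring

/-- `s ↦ ![s]` is measure preserving `ℝ → ℝ¹`. [folklore] -/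
theorem measurePreserving_vecOne :
    MeasurePreserving (fun s : ℝ => (![s] : Fin 1 → ℝ)) volume volume := by
  have hfun : (fun s : ℝ => (![s] : Fin 1 → ℝ)) = ⇑(MeasurableEquiv.funUnique (Fin 1) ℝ).symm := by
    funext s; ext i; fin_cases i; rfl
  rw [hfun]
  exact (volume_preserving_funUnique (Fin 1) ℝ).symm _

/-- A null set of `ℝ¹` pulls back to a null set of parameters. [folklore] -/
theorem volume_setOf_vecOne_mem {N : Set (Fin 1 → ℝ)} (hN : volume N = 0) :
    volume {s : ℝ | (![s] : Fin 1 → ℝ) ∈ N} = 0 :=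
  (measurePreserving_vecOne.measure_preimage (NullMeasurableSet.of_null hN)).trans hN

/-- A set of pairs whose first coordinate lies in a null set is null. [folklore] -/
theorem volume_fst_mem_eq_zero {S : Set ℝ} (hS : volume S = 0) :
    volume {q : ℝ × ℝ | q.1 ∈ S} = 0 := by
  have : {q : ℝ × ℝ | q.1 ∈ S} = S ×ˢ (univ : Set ℝ) := by ext q; simp
  rw [this, Measure.volume_eq_prod, Measure.prod_prod, hS, zero_mul]

/-- In dimension `1`: the densities of a domain-additivity instance add almost everywhere.
[folklore] -/
theorem dens_domainAdd_one {r r₁ r₂ : KZ.IntegralRep 1}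
    (hdom : r.domain = r₁.domain ∪ r₂.domain) (hnull : volume (r₁.domain ∩ r₂.domain) = 0)
    (h₁ : EqOn r.integrand r₁.integrand r₁.domain) (h₂ : EqOn r.integrand r₂.integrand r₂.domain) :
    (dens 1 r - dens 1 r₁ - dens 1 r₂) ∈ Nul := by
  rw [mem_Nul]
  have h0 := volume_fst_mem_eq_zero (volume_setOf_vecOne_mem hnull)
  have hae : ∀ᵐ q : ℝ × ℝ, (![q.1] : Fin 1 → ℝ) ∉ r₁.domain ∩ r₂.domain :=
    (measure_eq_zero_iff_ae_notMem (s := {q : ℝ × ℝ | q.1 ∈ {s : ℝ | (![s] : Fin 1 → ℝ) ∈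
      r₁.domain ∩ r₂.domain}})).1 h0
  filter_upwards [hae] with q hq
  simp only [Pi.sub_apply, Pi.zero_apply, dens_one]
  rw [indicator_domainAdd hdom h₁ h₂ hq]
  ring

/-- A Lebesgue-null subset of `ℝ⁰` is empty. [folklore] -/
theorem eq_empty_of_volume_fin_zero {N : Set (Fin 0 → ℝ)} (hN : volume N = 0) : N = ∅ := by
  by_contra h
  obtain ⟨x, hx⟩ := Set.nonempty_iff_ne_empty.2 h
  have hN' : N = univ := by
    ext y; simp only [mem_univ, iff_true]; rwa [Subsingleton.elim y x]
  rw [hN', volume_pi, Measure.pi_univ] at hN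
  simp at hN

/-- In dimension `0`: the densities of a domain-additivity instance add everywhere. [folklore] -/
theorem dens_domainAdd_zero {r r₁ r₂ : KZ.IntegralRep 0}
    (hdom : r.domain = r₁.domain ∪ r₂.domain) (hnull : volume (r₁.domain ∩ r₂.domain) = 0)
    (h₁ : EqOn r.integrand r₁.integrand r₁.domain) (h₂ : EqOn r.integrand r₂.integrand r₂.domain) :
    (dens 0 r - dens 0 r₁ - dens 0 r₂) ∈ Nul := by
  rw [mem_Nul]
  refine Filter.Eventually.of_forall fun q => ?_
  have hq : (![] : Fin 0 → ℝ) ∉ r₁.domain ∩ r₂.domain := by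
    rw [eq_empty_of_volume_fin_zero hnull]; exact notMem_empty _
  simp only [Pi.sub_apply, Pi.zero_apply, dens_zero]
  rw [indicator_domainAdd hdom h₁ h₂ hq]
  ring

/-! ### Vanishing on integrand additivity -/

/-- In dimension `≥ 2` the densities of an integrand-additivity instance add a.e. [folklore] -/
theorem dens_integrandAdd_two_add {r r₁ r₂ : KZ.IntegralRep (m + 2)}
    (hd₁ : r₁.domain = r.domain) (hd₂ : r₂.domain = r.domain)
    (hadd : EqOn r.integrand (r₁.integrand + r₂.integrand) r.domain) :
    (dens (m + 2) r - dens (m + 2) r₁ - dens (m + 2) r₂) ∈ Nul := by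
  rw [mem_Nul]
  filter_upwards [ae_integrable_slice2 (integrable_indicator r₁),
    ae_integrable_slice2 (integrable_indicator r₂)] with q hq₁ hq₂
  simp only [Pi.sub_apply, Pi.zero_apply, dens_two_add]
  have : (fun x => r.domain.indicator r.integrand (cons2 (q, x))) =
      fun x => r₁.domain.indicator r₁.integrand (cons2 (q, x)) +
        r₂.domain.indicator r₂.integrand (cons2 (q, x)) :=
    funext fun x => indicator_integrandAdd hd₁ hd₂ hadd _
  rw [this, integral_add hq₁ hq₂]
  ring

/-- In dimension `1` the densities of an integrand-additivity instance add. [folklore] -/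
theorem dens_integrandAdd_one {r r₁ r₂ : KZ.IntegralRep 1}
    (hd₁ : r₁.domain = r.domain) (hd₂ : r₂.domain = r.domain)
    (hadd : EqOn r.integrand (r₁.integrand + r₂.integrand) r.domain) :
    (dens 1 r - dens 1 r₁ - dens 1 r₂) ∈ Nul := by
  rw [mem_Nul]
  refine Filter.Eventually.of_forall fun q => ?_
  simp only [Pi.sub_apply, Pi.zero_apply, dens_one]
  rw [indicator_integrandAdd hd₁ hd₂ hadd]
  ring

/-- In dimension `0` the densities of an integrand-additivity instance add. [folklore] -/
theorem dens_integrandAdd_zero {r r₁ r₂ : KZ.IntegralRep 0}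
    (hd₁ : r₁.domain = r.domain) (hd₂ : r₂.domain = r.domain)
    (hadd : EqOn r.integrand (r₁.integrand + r₂.integrand) r.domain) :
    (dens 0 r - dens 0 r₁ - dens 0 r₂) ∈ Nul := by
  rw [mem_Nul]
  refine Filter.Eventually.of_forall fun q => ?_
  simp only [Pi.sub_apply, Pi.zero_apply, dens_zero]
  rw [indicator_integrandAdd hd₁ hd₂ hadd]
  ring

/-! ### Vanishing on Newton–Leibniz with base dimension `≥ 2` -/

/-- **Newton–Leibniz in a coordinate beyond the first two does not change the density** (a.e.).
[folklore] -/
theorem dens_newtonLeibniz_two_add {r : KZ.IntegralRep (m + 3)} {r' : KZ.IntegralRep (m + 2)}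
    {a b : (Fin (m + 2) → ℝ) → ℝ} {F : (Fin (m + 3) → ℝ) → ℝ}
    (hab : ∀ x ∈ r'.domain, a x ≤ b x)
    (hdom : r.domain = {z | (Fin.init z : Fin (m + 2) → ℝ) ∈ r'.domain ∧
      a (Fin.init z) ≤ z (Fin.last (m + 2)) ∧ z (Fin.last (m + 2)) ≤ b (Fin.init z)})
    (hcont : ∀ x ∈ r'.domain, ContinuousOn (fun t : ℝ => F (Fin.snoc x t)) (Icc (a x) (b x)))
    (hderiv : ∀ x ∈ r'.domain, ∀ t ∈ Ioo (a x) (b x),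
      HasDerivAt (fun s : ℝ => F (Fin.snoc x s)) (r.integrand (Fin.snoc x t)) t)
    (hbase : ∀ x ∈ r'.domain, r'.integrand x = F (Fin.snoc x (b x)) - F (Fin.snoc x (a x))) :
    (dens (m + 3) r - dens (m + 2) r') ∈ Nul := by
  rw [mem_Nul]
  filter_upwards [ae_integrable_slice2 (m := m + 1) (integrable_indicator r)] with q hq
  simp only [Pi.sub_apply, Pi.zero_apply, sub_eq_zero]
  rw [dens_two_add, dens_two_add]
  -- sliced data
  set τq : Set (Fin m → ℝ) := {y | cons2 (q, y) ∈ r'.domain} with hτq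
  set Bq : Set (Fin (m + 1) → ℝ) := {z | cons2 (q, z) ∈ r.domain} with hBq
  have hτqm : MeasurableSet τq :=
    measurable_cons2_mk q (KZ.IntegralRep.measurableSet_domain_holds r')
  have hBqm : MeasurableSet Bq :=
    measurable_cons2_mk q (KZ.IntegralRep.measurableSet_domain_holds r)
  have hind : ∀ z, r.domain.indicator r.integrand (cons2 (q, z)) =
      Bq.indicator (fun z => r.integrand (cons2 (q, z))) z := fun z => by
    by_cases hz : cons2 (q, z) ∈ r.domain
    · rw [indicator_of_mem hz, indicator_of_mem (show z ∈ Bq from hz)]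
    · rw [indicator_of_notMem hz, indicator_of_notMem (show z ∉ Bq from hz)]
  have hind' : ∀ y, r'.domain.indicator r'.integrand (cons2 (q, y)) =
      τq.indicator (fun y => r'.integrand (cons2 (q, y))) y := fun y => by
    by_cases hy : cons2 (q, y) ∈ r'.domain
    · rw [indicator_of_mem hy, indicator_of_mem (show y ∈ τq from hy)]
    · rw [indicator_of_notMem hy, indicator_of_notMem (show y ∉ τq from hy)]
  have hint : IntegrableOn (fun z => r.integrand (cons2 (q, z))) Bq := by
    rw [← integrable_indicator_iff hBqm]
    exact hq.congr (Filter.Eventually.of_forall hind)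
  simp_rw [hind, hind', integral_indicator hBqm, integral_indicator hτqm]
  have key := integral_band_eq (τ := τq) hτqm (a := fun y => a (cons2 (q, y)))
    (b := fun y => b (cons2 (q, y))) (F := fun z => F (cons2 (q, z)))
    (g := fun z => r.integrand (cons2 (q, z))) (B := Bq) hBqm
    (fun y hy => hab _ hy) ?_ ?_ ?_ hint
  · rw [key]
    refine setIntegral_congr_fun hτqm fun y hy => ?_
    simp only [cons2_snoc]
    exact (hbase _ hy).symm
  · ext z
    simp only [hBq, hτq, mem_setOf_eq, hdom, init_cons2, cons2_apply_last]
  · intro y hy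
    simp only [cons2_snoc]
    exact hcont _ hy
  · intro y hy t ht
    simp only [cons2_snoc]
    exact hderiv _ hy t ht

/-! ### The invariant -/

/-- Newton–Leibniz differences with base dimension `1` (data kept: the primitive and the band). -/
def DgenOne : Set (ℝ × ℝ → ℝ) :=
  {g | ∃ (r : KZ.IntegralRep 2) (r' : KZ.IntegralRep 1) (a b : (Fin 1 → ℝ) → ℝ)
      (F : (Fin 2 → ℝ) → ℝ),
    IsSemialgebraicFunOn ℚ r.domain F ∧ (∀ x ∈ r'.domain, a x ≤ b x) ∧
    r.domain = {z | (Fin.init z : Fin 1 → ℝ) ∈ r'.domain ∧ a (Fin.init z) ≤ z (Fin.last 1) ∧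
      z (Fin.last 1) ≤ b (Fin.init z)} ∧
    (∀ x ∈ r'.domain, ContinuousOn (fun t : ℝ => F (Fin.snoc x t)) (Icc (a x) (b x))) ∧
    (∀ x ∈ r'.domain, ∀ t ∈ Ioo (a x) (b x),
      HasDerivAt (fun s : ℝ => F (Fin.snoc x s)) (r.integrand (Fin.snoc x t)) t) ∧
    (∀ x ∈ r'.domain, r'.integrand x = F (Fin.snoc x (b x)) - F (Fin.snoc x (a x))) ∧
    g = dens 2 r - dens 1 r'}

/-- Newton–Leibniz differences with base dimension `0`. -/
def DgenZero : Set (ℝ × ℝ → ℝ) :=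
  {g | ∃ (r : KZ.IntegralRep 1) (r' : KZ.IntegralRep 0), g = dens 1 r - dens 0 r'}

/-- The subgroup of low-dimensional Newton–Leibniz differences. -/
def Dsub : AddSubgroup (ℝ × ℝ → ℝ) := AddSubgroup.closure (DgenOne ∪ DgenZero)

/-- The kernel of the invariant: a.e.-zero functions plus low-dimensional NL differences. -/
def Ksub : AddSubgroup (ℝ × ℝ → ℝ) := Nul ⊔ Dsub

/-- **The push-forward invariant** `ι : FormalRep →+ (ℝ² → ℝ) ⧸ K`. -/
def invariant : KZ.FormalRep →+ (ℝ × ℝ → ℝ) ⧸ Ksub :=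
  FreeAbelianGroup.lift fun p => (QuotientAddGroup.mk (dens p.1 p.2) : (ℝ × ℝ → ℝ) ⧸ Ksub)

/-- The invariant of a generator is the class of its density. [folklore] -/
theorem invariant_of {n : ℕ} (r : KZ.IntegralRep n) :
    invariant (KZ.of r) = (QuotientAddGroup.mk (dens n r) : (ℝ × ℝ → ℝ) ⧸ Ksub) := by
  simp [invariant, KZ.of]

/-- Classes of a.e.-zero functions vanish. [folklore] -/
theorem mk_eq_zero_of_mem_Nul {g : ℝ × ℝ → ℝ} (hg : g ∈ Nul) :
    (QuotientAddGroup.mk g : (ℝ × ℝ → ℝ) ⧸ Ksub) = 0 :=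
  (QuotientAddGroup.eq_zero_iff g).2 (AddSubgroup.mem_sup_left hg)

/-- Classes of low-dimensional Newton–Leibniz differences vanish. [folklore] -/
theorem mk_eq_zero_of_mem_Dsub {g : ℝ × ℝ → ℝ} (hg : g ∈ Dsub) :
    (QuotientAddGroup.mk g : (ℝ × ℝ → ℝ) ⧸ Ksub) = 0 :=
  (QuotientAddGroup.eq_zero_iff g).2 (AddSubgroup.mem_sup_right hg)

/-- **The invariant kills the change-of-variables-free sub-calculus.** [folklore] -/
theorem relationsWithoutCoV_le_ker : relationsWithoutCoV ≤ invariant.ker := by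
  refine (AddSubgroup.closure_le _).mpr ?_
  rintro c ((hc | hc) | hc)
  · obtain ⟨n, r, r₁, r₂, hdom, hnull, h₁, h₂, rfl⟩ := hc
    rw [SetLike.mem_coe, AddMonoidHom.mem_ker, map_sub, map_sub, invariant_of, invariant_of,
      invariant_of, ← QuotientAddGroup.mk_sub, ← QuotientAddGroup.mk_sub]
    apply mk_eq_zero_of_mem_Nul
    rcases n with _ | _ | m
    · exact dens_domainAdd_zero hdom hnull h₁ h₂
    · exact dens_domainAdd_one hdom hnull h₁ h₂
    · exact dens_domainAdd_two_add hdom hnull h₁ h₂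
  · obtain ⟨n, r, r₁, r₂, hd₁, hd₂, hadd, rfl⟩ := hc
    rw [SetLike.mem_coe, AddMonoidHom.mem_ker, map_sub, map_sub, invariant_of, invariant_of,
      invariant_of, ← QuotientAddGroup.mk_sub, ← QuotientAddGroup.mk_sub]
    apply mk_eq_zero_of_mem_Nul
    rcases n with _ | _ | m
    · exact dens_integrandAdd_zero hd₁ hd₂ hadd
    · exact dens_integrandAdd_one hd₁ hd₂ hadd
    · exact dens_integrandAdd_two_add hd₁ hd₂ hadd
  · obtain ⟨n, r, r', a, b, F, hF, -, -, hab, hdom, hcont, hderiv, hbase, rfl⟩ := hc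
    rw [SetLike.mem_coe, AddMonoidHom.mem_ker, map_sub, invariant_of, invariant_of,
      ← QuotientAddGroup.mk_sub]
    rcases n with _ | _ | m
    · exact mk_eq_zero_of_mem_Dsub (AddSubgroup.subset_closure (Or.inr ⟨r, r', rfl⟩))
    · exact mk_eq_zero_of_mem_Dsub (AddSubgroup.subset_closure
        (Or.inl ⟨r, r', a, b, F, hF, hab, hdom, hcont, hderiv, hbase, rfl⟩))
    · exact mk_eq_zero_of_mem_Nul (dens_newtonLeibniz_two_add hab hdom hcont hderiv hbase)


end Summit.KontsevichZagierPeriods.DihedralNormalForm.Negative
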